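import Literature.MathematicalPhysics.QuantumFieldTheory.Balaban1983to89.Node00.Record13CarriersXPinnedHSViewCoPH

/-!
# BalabanUVNodes ∕ N05 ([B8], `Dag.B8_main`) AT THE K1 ENGINE'S X-PINNED VIEW (v1.7 key `SepCoPH`) — THE GENERIC LEAF-TO-RECORD FACES: ANY residual [B8] layer
# carrying the REPAIRED slot `B8LeafOfRecordSubBH` gives N05 in ∃-currency at the S-BOUND FOUR-PIN X-H record `Node00.IsRecordOfRecord₁₃CSepCoPHSX3HV` (+ same-datum
# `₁₃CSepCoPH` companion) and, in one term, at dag-n10-d's generic S-class `Node00.IsRecordOfRecord₁₃CSepCoPHS` (the K1 skeleton's `RecordS` twin)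

Track A of `YM-PLAN.md` (cell `pub-ymgap`, HUMAN RULING D-0062), node **N05** = [Balaban1985RegularSpaces] Lemma 1, Thm 2, Prop 3, Thm 4, Props 5–7, Thm 8; seat
`pub-ymgap-dag-n05-d` (g8), 2026-08-27; strategy s2.  Inputs BY NAME: `Node00/Record13CarriersXPinnedHSViewCoPH` (this seat g7, p548139: the S-bound four-pin X-H v1.7
record, `exists_world_isRecordOfRecord₁₃CSepCoPH`, `companion_of_isRecordOfRecord₁₃CSepCoPHSX3HV`, `socket05S_view₁₃CoPHB10YZW_pinX3H_iff`, `b8_b11_b10_main_iff_of_…`,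
`isRecordOfRecord₁₃CSepCoPHS_of_isRecordOfRecord₁₃CSepCoPHSX3HV`).  The served-knit image `BalabanUVNodesN05AtXPinnedHSViewSepCoPHT8Srv` (p549041) inlined this passage for
ONE layer (the knit's `lam.cutSubB …`); THIS file states it for ANY layer, so that every leaf-level closer — the junction-applied closer
`BalabanUVNodesN05SubBHKnitUnivOfThm33.exists_b8LeafOfRecordSubBH_cutSubB_zdLan_of_thm33_lettersRDU_univ` (p551339: ∃ layer from N06's Theorem 3.3 by name), its successors
with Proposition 6 supplied, or any other — is read at the record in two lines.

WHAT IS PROVED (composition BY NAME; no estimate; no new definition):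
* `exists_isRecordOfRecord₁₃CSepCoPHSX3HV_b8_of_leaf` — for ANY residual [B8] layer `lam8` at which `B8LeafOfRecordSubBH θ.toStage3Params lam8` holds, admissible
  `θ : Stage13HParams F N` with v1.7 provisos `h`, any `lam12 lam13 Mstar ops ζ lamW` and window `γw ∈ ]0, θ.γ]`: worlds `w w′` with
  `IsRecordOfRecord₁₃CSepCoPHSX3HV F N (datumOfRecord₁₃SepCoPH θ h) w`, binding DISPLAYED at `(θ.pinX3H lam8 lam12 lam13).view₁₃CoPHB10YZW …`, every run's `b8` leaf and
  `Dag.B8_main`, and the same-datum `₁₃CSepCoPH` companion `w′` (leaves equal off `b8`).  (The proof of p549041, with the leaf as the hypothesis.)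
* `exists_isRecordOfRecord₁₃CSepCoPHS_b8_of_leaf` — the same in dag-n10-d's generic S-class (one term through the four-pin-view slice).
HONEST FRAMING: kernel bookkeeping by name; the leaf is the HYPOTHESIS; count-neutral; **N05 NOT discharged**; K1 NOT claimed; A2: inhabitation of `(θ, h)` = K0⁷ (open); one
finite 𝕋⁴ programme at fixed ε; nothing continuum ∕ ℝ⁴ ∕ OS ∕ mass-gap ∕ Clay.  No `sorry`, no new definition.
[cite: Balaban1989LargeFieldII, Thm 1 + (0.1) pp.355–356 (the record, bookkeeping); Balaban1985RegularSpaces, Thm 2 p.83, Thm 8 p.101 (the slot read)]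
-/

noncomputable section

namespace Summit.QuantumFields.YangMills.BalabanUVNodes.N05AtXPinnedHSViewSepCoPHOfLeaf


open Literature.MathematicalPhysics.QuantumFieldTheory.Balaban1983to89
open Literature.MathematicalPhysics.QuantumFieldTheory.Balaban1983to89.Node00
open Literature.MathematicalPhysics.QuantumFieldTheory.Balaban1983to89.T4Continuum
open Literature.MathematicalPhysics.QuantumFieldTheory.Balaban1983to89.DagBinding

variable {F : T4Family} {N : ℕ} [NeZero N]

/-! ## The GENERIC leaf-to-record face (any residual [B8] layer carrying the repaired slot) -/

section OfLeaf

/-- **THE LEAF-TO-RECORD FACE AT THE S-BOUND FOUR-PIN X-H v1.7 RECORD, FOR ANY LAYER**: admissible `θ` with v1.7 provisos `h`, ANY residual [B8] layer `lam8` at which the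
REPAIRED slot `B8LeafOfRecordSubBH θ.toStage3Params lam8` holds, any `lam12 lam13 Mstar ops ζ lamW`, any window `γw ∈ ]0, θ.γ]` ⇒ worlds `w w′`:
`IsRecordOfRecord₁₃CSepCoPHSX3HV F N (datumOfRecord₁₃SepCoPH θ h) w` with its binding DISPLAYED at `(θ.pinX3H lam8 lam12 lam13).view₁₃CoPHB10YZW Mstar ops ζ lamW`, EVERY run's
`b8` leaf and `Dag.B8_main (leavesP w P)` (`socket05S_view₁₃CoPHB10YZW_pinX3H_iff`, `b8_b11_b10_main_iff_of_…`), and the same-datum companion `IsRecordOfRecord₁₃CSepCoPH … w′`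
(leaves equal off `b8`; the companion's typed `b8` NOT claimed).  The proof of p549041 with the leaf as the hypothesis; bookkeeping.
[cite: Balaban1989LargeFieldII, Thm 1 + (0.1) pp.355–356 (the record, bookkeeping); Balaban1985RegularSpaces, Thm 2 p.83, Thm 8 p.101 (the slot read)] -/
theorem exists_isRecordOfRecord₁₃CSepCoPHSX3HV_b8_of_leaf (θ : Stage13HParams F N) (h : θ.Provisos₁₃SepCoPH F N) (hθ : θ.Admissible F N)
    (lam8 : ResidB8 θ.toStage3Params) (lam12 : ResidB12 F N θ.τ9.M) (lam13 : B12.RunParams → ResidB13 θ.toStage3Params) (Mstar : ℕ)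
    (ops : OpsY N θ.toStage3Params Mstar) (ζ : ResidZ F N) (lamW : ResidW F N) (hleaf : B8LeafOfRecordSubBH θ.toStage3Params lam8)
    {γw : ℝ} (hγ0 : 0 < γw) (hγ1 : γw ≤ θ.γ) :
    ∃ w w' : WorldP, IsRecordOfRecord₁₃CSepCoPHSX3HV F N (datumOfRecord₁₃SepCoPH F N θ h) w ∧
      w.C = (datumOfRecord₁₃SepCoPH F N θ h).C ∧ w.γ = γw ∧ w.L = (θ.L : ℝ) ∧
      (∀ P : B12.RunParams, w.up P = upOfRecord₅CS F N ((θ.pinX3H F N lam8 lam12 lam13).view₁₃CoPHB10YZW F N Mstar ops ζ lamW) P) ∧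
      (∀ P : B12.RunParams, (leavesP w P).b8 ∧ Dag.B8_main (leavesP w P)) ∧
      IsRecordOfRecord₁₃CSepCoPH F N (datumOfRecord₁₃SepCoPH F N θ h) w' ∧ w'.C = w.C ∧ w'.γ = w.γ ∧ w'.L = w.L ∧
      ∀ P : B12.RunParams, leavesP w P = { leavesP w' P with b8 := (leavesP w P).b8 } := by
  obtain ⟨w₀, -, -⟩ := exists_world_isRecordOfRecord₁₃CSepCoPH F N θ h hθ ⟨hγ0, hγ1⟩
  have hrec : IsRecordOfRecord₁₃CSepCoPHSX3HV F N (datumOfRecord₁₃SepCoPH F N θ h)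
      { w₀ with
        C := (datumOfRecord₁₃SepCoPH F N θ h).C, γ := γw, L := (θ.L : ℝ), one_lt_L := by exact_mod_cast θ.hL.2,
        up := fun P => upOfRecord₅CS F N ((θ.pinX3H F N lam8 lam12 lam13).view₁₃CoPHB10YZW F N Mstar ops ζ lamW) P } :=
    ⟨θ, h, _, lam12, lam13, Mstar, ops, ζ, lamW, hθ, rfl, rfl, ⟨hγ0, hγ1⟩, rfl, fun _ => rfl⟩
  obtain ⟨w', hw', hC', hγ', hL', hleaves, -⟩ := companion_of_isRecordOfRecord₁₃CSepCoPHSX3HV hrec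
  refine ⟨_, w', hrec, rfl, rfl, rfl, fun _ => rfl, fun P => ?_, hw', hC', hγ', hL', hleaves⟩
  have hb8 : (upOfRecord₅CS F N ((θ.pinX3H F N lam8 lam12 lam13).view₁₃CoPHB10YZW F N Mstar ops ζ lamW) P).b8 :=
    (socket05S_view₁₃CoPHB10YZW_pinX3H_iff F N θ _ lam12 lam13 Mstar ops ζ lamW P).2 hleaf
  obtain ⟨h8iff, -, -⟩ := b8_b11_b10_main_iff_of_isRecordOfRecord₁₃CSepCoPHSX3HV hrec P
  exact ⟨hb8, h8iff.2 fun _ => hb8⟩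

/-- **THE SAME FACE IN dag-n10-d's GENERIC S-CLASS CURRENCY** `Node00.IsRecordOfRecord₁₃CSepCoPHS` (`Record13SClassSepCoPH`, p542283 — the tree twin of the K1 skeleton's
`RecordS`): ANY layer `lam8` carrying the repaired slot gives an S-class world at the datum of record with window `γw`, block size `θ.L`, binding displayed at the four-pin X-H
view, and EVERY run's `b8` leaf and `Dag.B8_main` — through the four-pin-view SLICE `isRecordOfRecord₁₃CSepCoPHS_of_isRecordOfRecord₁₃CSepCoPHSX3HV` (one term).  With
`BalabanUVNodesN05SubBHKnitUnivOfThm33` (∃ layer from N06's Theorem 3.3 by name) this is N05's conjunct of the K1 rung in two lines; bookkeeping.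
[cite: Balaban1989LargeFieldII, Thm 1 + (0.1) pp.355–356 (the record, bookkeeping); Balaban1985RegularSpaces, Thm 2 p.83, Thm 8 p.101 (the slot read)] -/
theorem exists_isRecordOfRecord₁₃CSepCoPHS_b8_of_leaf (θ : Stage13HParams F N) (h : θ.Provisos₁₃SepCoPH F N) (hθ : θ.Admissible F N)
    (lam8 : ResidB8 θ.toStage3Params) (lam12 : ResidB12 F N θ.τ9.M) (lam13 : B12.RunParams → ResidB13 θ.toStage3Params) (Mstar : ℕ)
    (ops : OpsY N θ.toStage3Params Mstar) (ζ : ResidZ F N) (lamW : ResidW F N) (hleaf : B8LeafOfRecordSubBH θ.toStage3Params lam8)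
    {γw : ℝ} (hγ0 : 0 < γw) (hγ1 : γw ≤ θ.γ) :
    ∃ w : WorldP, IsRecordOfRecord₁₃CSepCoPHS F N (datumOfRecord₁₃SepCoPH F N θ h) w ∧
      w.C = (datumOfRecord₁₃SepCoPH F N θ h).C ∧ w.γ = γw ∧ w.L = (θ.L : ℝ) ∧
      (∀ P : B12.RunParams, w.up P = upOfRecord₅CS F N ((θ.pinX3H F N lam8 lam12 lam13).view₁₃CoPHB10YZW F N Mstar ops ζ lamW) P) ∧
      ∀ P : B12.RunParams, (leavesP w P).b8 ∧ Dag.B8_main (leavesP w P) := by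
  obtain ⟨w, -, hrec, hC, hγ, hL, hup, hb8, -⟩ :=
    exists_isRecordOfRecord₁₃CSepCoPHSX3HV_b8_of_leaf θ h hθ lam8 lam12 lam13 Mstar ops ζ lamW hleaf hγ0 hγ1
  exact ⟨w, isRecordOfRecord₁₃CSepCoPHS_of_isRecordOfRecord₁₃CSepCoPHSX3HV hrec, hC, hγ, hL, hup, hb8⟩

end OfLeaf

#print axioms exists_isRecordOfRecord₁₃CSepCoPHSX3HV_b8_of_leaf
#print axioms exists_isRecordOfRecord₁₃CSepCoPHS_b8_of_leaf

end Summit.QuantumFields.YangMills.BalabanUVNodes.N05AtXPinnedHSViewSepCoPHOfLeaf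

end
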